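import Mathlib
import Literature.Analysis.FluidPDE.LerayHopf
import Literature.Analysis.FluidPDE.BoundedLerayHopfClay
import Literature.Analysis.FluidPDE.KatoLocalL3L5
import Literature.Analysis.FunctionSpaces.TestPairingLimits
import Summits.NavierStokesRegularity.NavierStokesRegularity.Theses.RootDecompEpochRecut
import HarnessLib

/-!
# RootDecompEpochRecut — aside SEP `SeparationEpoch` (stmt-NavierStokesRegularity-30483) PROVED

Route N21 `route-NavierStokesRegularity-RootDecompEpochRecut` (lens-3 g7 «THE EPOCH RECUT»; writer g3), aside item
SEP («COSTUME(plumbing), PROVABLE NOW»): **the separation epoch.** Two global Leray–Hopf flows `u, v` from one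
Clay datum (smooth, divergence free, rapidly decaying) that differ a.e.-essentially at some positive time agree
a.e. at every time of some `(0, τ]`, `τ > 0`, and differ at times arbitrarily close after `τ`.

Proof (as the item's docstring prescribes, with the tree's Kato local theory in place of Tao's):
* LOCAL AGREEMENT — the Clay datum is in `L³` and weakly divergence free, so a Kato mild solution `w` exists
  on some `[0, T₀)` (`exists_isKatoSolutionOn_memLqLp_five`, Kato 1984); every global Leray–Hopf flow from the
  datum agrees with `w` a.e. on `(0, T₀)` (`IsGlobalLerayHopf.ae_eq_of_isKatoSolutionOn_of_decay`: Prodi–Serrin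
  weak–strong uniqueness through the bounded Tao-class representative), hence `u s = v s` a.e. for `s ∈ (0,T₀)`;
* THE EPOCH — `τ := sSup {t > 0 | u = v a.e. at every time of (0, t]}` (non-empty, bounded by the separation
  time); below `τ` the flows agree by the supremum property;
* AT `τ` — weak `L²`-continuity of Leray–Hopf slices (field `weak_continuous` of `IsLerayHopfOn τ`): the
  pairings `∫⟪u s, φ⟫ = ∫⟪v s, φ⟫`, `s ↑ τ`, converge to `∫⟪u τ, φ⟫` resp. `∫⟪v τ, φ⟫`, so the terminal slices
  have the same pairings against every test field, hence agree a.e. (du Bois-Reymond,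
  `FunctionSpaces.ae_eq_of_forall_integral_inner_test_eq`);
* AFTER `τ` — if the flows agreed a.e. at every time of `(τ, τ + δ)` then `τ + δ/2` would lie in the set,
  contradicting `sSup`.
Plumbing toward S (support of U 25531's dossier: with RB∞ it makes the separation calculus unconditional);
Navier–Stokes regularity is NOT proved by anything here (rung 0).
-/

noncomputable section

-- the summit and its single sub-problem share the name (CONVENTIONS §1), as in every Theorems file
set_option linter.dupNamespace false

open MeasureTheory Set Filter Topology
open scoped ENNReal NNReal ContDiff RealInnerProductSpace
open Literature.Analysis.FluidPDE Literature.Analysis.FunctionSpaces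

namespace Summit.NavierStokesRegularity.NavierStokesRegularity.Theorems.EpochRecut

/-! ### Local agreement of global Leray–Hopf flows from a Clay datum -/

/-- **Local agreement.** Two global Leray–Hopf flows from one Clay datum agree a.e. at every time of some
`(0, T₀)`, `T₀ > 0`: both agree there with the Kato mild solution from the datum (Kato 1984 local existence in
`L³` + Prodi–Serrin weak–strong uniqueness, tree theorems `exists_isKatoSolutionOn_memLqLp_five` and
`IsGlobalLerayHopf.ae_eq_of_isKatoSolutionOn_of_decay`). [cite: LemarieRieusset2016, Prop. 12.3 with Thm. 7.7] -/
theorem exists_pos_forall_ae_eq {ν : ℝ} (hν : 0 < ν)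
    {u₀ : EuclideanSpace ℝ (Fin 3) → EuclideanSpace ℝ (Fin 3)} (hsm : ContDiff ℝ ∞ u₀)
    (hdiv : NSWave0.IsDivFree u₀) (hdec : HasRapidSpatialDecay u₀)
    {u v : ℝ → EuclideanSpace ℝ (Fin 3) → EuclideanSpace ℝ (Fin 3)}
    (hu : IsGlobalLerayHopf ν 0 u₀ u) (hv : IsGlobalLerayHopf ν 0 u₀ v) :
    ∃ T₀ : ℝ, 0 < T₀ ∧ ∀ t ∈ Ioo 0 T₀, u t =ᵐ[volume] v t := by
  have hdiv' : VectorCalculus.IsDivFree u₀ := fun x => hdiv x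
  -- the datum: `L²`, `L³`, weakly divergence free (as in `clay_solution_of_locallyBounded_globalLerayHopf`)
  have hHk : ∀ n : ℕ, ∫⁻ x, ‖iteratedFDeriv ℝ n u₀ x‖ₑ ^ 2 < ⊤ :=
    hdec.lintegral_enorm_iteratedFDeriv_sq_lt_top
  have hmeas0 : AEStronglyMeasurable u₀ volume := hsm.continuous.aestronglyMeasurable
  have hL2 : ∫⁻ x, ‖u₀ x‖ₑ ^ 2 < ⊤ := by
    refine lt_of_le_of_lt (le_of_eq (lintegral_congr fun x => ?_)) (hHk 0)
    rw [← ofReal_norm, ← ofReal_norm, norm_iteratedFDeriv_zero]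
  have hu2 : MemLp u₀ 2 volume := ⟨hmeas0, eLpNorm_two_lt_top_of_lintegral_enorm_sq_lt_top hL2⟩
  obtain ⟨C₀, hC₀⟩ := hdec 0 0
  have hbd0 : ∀ x, ‖u₀ x‖ ≤ C₀ := fun x => by
    have h := hC₀ x
    rwa [pow_zero, one_mul, norm_iteratedFDeriv_zero] at h
  have hu3 : MemLp u₀ 3 volume := by
    refine ⟨hmeas0, ?_⟩
    have h3 : eLpNorm u₀ 3 volume ^ 3 ≤ eLpNorm u₀ ⊤ volume * eLpNorm u₀ 2 volume ^ 2 :=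
      eLpNorm_three_pow_le hmeas0
    have htop : eLpNorm u₀ ⊤ volume ≤ ENNReal.ofReal C₀ := eLpNorm_top_le_of_bound hbd0
    have hfin : eLpNorm u₀ ⊤ volume * eLpNorm u₀ 2 volume ^ 2 < ⊤ :=
      ENNReal.mul_lt_top (htop.trans_lt ENNReal.ofReal_lt_top) (ENNReal.pow_lt_top hu2.eLpNorm_lt_top)
    by_contra hnot
    rw [not_lt, top_le_iff] at hnot
    rw [hnot, ENNReal.top_pow (by norm_num)] at h3
    exact absurd (h3.trans_lt hfin) (lt_irrefl _)
  have hwdiv : IsWeaklyDivFree u₀ :=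
    VectorCalculus.IsDivFree.isWeaklyDivFree_holds hdiv' (hsm.of_le (mod_cast le_top))
  -- Kato's local mild solution and weak–strong uniqueness for both flows
  obtain ⟨T₀, hT₀, w, hw, -, -⟩ := exists_isKatoSolutionOn_memLqLp_five hν hu3 hwdiv
  refine ⟨T₀, hT₀, fun t ht => ?_⟩
  exact (hu.ae_eq_of_isKatoSolutionOn_of_decay hν hsm hdiv' hdec hw t ht).trans
    (hv.ae_eq_of_isKatoSolutionOn_of_decay hν hsm hdiv' hdec hw t ht).symm

/-! ### Identification at the epoch by weak `L²`-continuity -/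

/-- **Agreement passes to the epoch.** If two Leray–Hopf solutions on `[0, τ]` (any forces, any data) agree
a.e. at every time of `(0, τ)`, they agree a.e. at `τ`: the pairings against a test field are continuous from
the left at `τ` (field `weak_continuous`), so `u τ` and `v τ` have the same pairings against every smooth
compactly supported field and the du Bois-Reymond lemma applies. [folklore] -/
theorem ae_eq_at_of_forall_ae_eq_Ioo {ν τ : ℝ} (hτ : 0 < τ)
    {f g : ℝ → EuclideanSpace ℝ (Fin 3) → EuclideanSpace ℝ (Fin 3)}
    {a b : EuclideanSpace ℝ (Fin 3) → EuclideanSpace ℝ (Fin 3)}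
    {u v : ℝ → EuclideanSpace ℝ (Fin 3) → EuclideanSpace ℝ (Fin 3)}
    (hu : IsLerayHopfOn τ ν f a u) (hv : IsLerayHopfOn τ ν g b v)
    (h : ∀ s ∈ Ioo 0 τ, u s =ᵐ[volume] v s) : u τ =ᵐ[volume] v τ := by
  have hmu : MemLp (u τ) 2 volume := hu.memLp τ ⟨hτ.le, le_rfl⟩
  have hmv : MemLp (v τ) 2 volume := hv.memLp τ ⟨hτ.le, le_rfl⟩
  refine ae_eq_of_forall_integral_inner_test_eq (hmu.locallyIntegrable one_le_two)
    (hmv.locallyIntegrable one_le_two) fun φ hφ => ?_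
  -- the test field is in `L²`
  have hφ2 : MemLp φ 2 volume := hφ.contDiff.continuous.memLp_of_hasCompactSupport hφ.hasCompactSupport
  -- the left filter at `τ` sits inside `(0, τ]`
  have hle_filter : 𝓝[<] τ ≤ 𝓝[Ioc 0 τ] τ := by
    rw [← nhdsWithin_Ioo_eq_nhdsLT hτ]
    exact nhdsWithin_mono _ Ioo_subset_Ioc_self
  have hlu : Tendsto (fun s => ∫ x, ⟪u s x, φ x⟫) (𝓝[<] τ) (𝓝 (∫ x, ⟪u τ x, φ x⟫)) :=
    (((hu.weak_continuous φ hφ2).1) τ ⟨hτ, le_rfl⟩).tendsto.mono_left hle_filter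
  have hlv : Tendsto (fun s => ∫ x, ⟪v s x, φ x⟫) (𝓝[<] τ) (𝓝 (∫ x, ⟪v τ x, φ x⟫)) :=
    (((hv.weak_continuous φ hφ2).1) τ ⟨hτ, le_rfl⟩).tendsto.mono_left hle_filter
  -- below `τ` the pairings coincide
  have hev : (fun s => ∫ x, ⟪u s x, φ x⟫) =ᶠ[𝓝[<] τ] fun s => ∫ x, ⟪v s x, φ x⟫ := by
    filter_upwards [Ioo_mem_nhdsLT hτ] with s hs
    exact integral_congr_ae ((h s hs).mono fun x hx => by
      show ⟪u s x, φ x⟫ = ⟪v s x, φ x⟫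
      rw [hx])
  exact tendsto_nhds_unique (hlu.congr' hev) hlv

/-! ### The aside -/

/-- **Aside SEP `SeparationEpoch` (stmt-NavierStokesRegularity-30483) holds**: two global Leray–Hopf flows from
one Clay datum that differ at some positive time agree a.e. at every time of some `(0, τ]`, `τ > 0`, and differ
at times arbitrarily close after `τ` (`τ` = the supremum of the agreement times; local agreement by Kato +
weak–strong uniqueness, agreement AT `τ` by weak `L²`-continuity, separation after `τ` by the supremum
property). [cite: LemarieRieusset2016, Prop. 12.3 with Thm. 7.7] -/
theorem separationEpoch_proof : Theses.RootDecompEpochRecut.SeparationEpoch := by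
  unfold Theses.RootDecompEpochRecut.SeparationEpoch
  intro ν hν u₀ hsm hdiv hdec u v hu hv hsep
  obtain ⟨t₁, ht₁, hne⟩ := hsep
  obtain ⟨T₀, hT₀, hloc⟩ := exists_pos_forall_ae_eq hν hsm hdiv hdec hu hv
  -- the agreement set and its supremum
  set A : Set ℝ := {t : ℝ | 0 < t ∧ ∀ s ∈ Ioc 0 t, u s =ᵐ[volume] v s} with hA
  have hmemA : T₀ / 2 ∈ A := by
    refine ⟨by positivity, fun s hs => hloc s ⟨hs.1, ?_⟩⟩
    exact lt_of_le_of_lt hs.2 (by linarith)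
  have hAne : A.Nonempty := ⟨_, hmemA⟩
  have hAlt : ∀ t ∈ A, t < t₁ := by
    intro t ht
    by_contra hle
    exact hne (ht.2 t₁ ⟨ht₁, not_lt.1 hle⟩)
  have hAbdd : BddAbove A := ⟨t₁, fun t ht => (hAlt t ht).le⟩
  set τ : ℝ := sSup A with hτdef
  have hτpos : 0 < τ := lt_of_lt_of_le (by positivity : (0 : ℝ) < T₀ / 2) (le_csSup hAbdd hmemA)
  -- agreement strictly below the epoch
  have hbelow : ∀ s ∈ Ioo 0 τ, u s =ᵐ[volume] v s := by
    intro s hs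
    obtain ⟨t, htA, hst⟩ := exists_lt_of_lt_csSup hAne hs.2
    exact htA.2 s ⟨hs.1, hst.le⟩
  -- agreement at the epoch (weak `L²`-continuity of both flows on `(0, τ]`)
  have hat : u τ =ᵐ[volume] v τ :=
    ae_eq_at_of_forall_ae_eq_Ioo hτpos (hu τ hτpos) (hv τ hτpos) hbelow
  have hIoc : ∀ t ∈ Ioc 0 τ, u t =ᵐ[volume] v t := by
    intro t ht
    rcases ht.2.lt_or_eq with hlt | heq
    · exact hbelow t ⟨ht.1, hlt⟩
    · rw [heq]; exact hat
  refine ⟨τ, hτpos, hIoc, fun δ hδ => ?_⟩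
  -- separation right after the epoch
  by_contra hno
  push Not at hno
  have hmem : τ + δ / 2 ∈ A := by
    refine ⟨by positivity, fun s hs => ?_⟩
    rcases le_or_gt s τ with hsτ | hsτ
    · exact hIoc s ⟨hs.1, hsτ⟩
    · by_contra hns
      exact hns (by
        have := hno s hsτ (lt_of_le_of_lt hs.2 (by linarith))
        exact this)
  have hle : τ + δ / 2 ≤ τ := le_csSup hAbdd hmem
  linarith

end Summit.NavierStokesRegularity.NavierStokesRegularity.Theorems.EpochRecut

end
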